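import Mathlib.RingTheory.Polynomial.Chebyshev
import Mathlib.Analysis.SpecialFunctions.Pow.Real
import Mathlib.Analysis.Calculus.Deriv.Basic
import Literature.MathematicalPhysics.QuantumLattice.GaugeGroups
import HarnessLib

/-!
# Tomboulis's potential-moving decimation bounds for the `SU(2)` vortex free energy, and the inequality
# disputed by Ito–Seiler — the finite-volume OBJECTS and the printed CLAIMS, as `Prop`s

Topic `Literature/MathematicalPhysics/QuantumFieldTheory` (next to `LatticeGauge*.lean`; torus vocabulary
of `ConstructiveQFTWave0`: `Site d L`, `Plaquette d L`, `GaugeConfig d L G`, `plaquetteHolonomy`,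
`haarProbability`). This file TYPES, for the gauge group `SU(2)` on the periodic lattice `(ℤ/Lℤ)^d`,
the objects of E. T. Tomboulis, *Confinement for all values of the coupling in four-dimensional SU(2)
gauge theory*, arXiv:0707.2179 (2007) [Tomboulis2007Confinement] §§2–5, and records as `Prop`-valued
definitions (NOTHING is asserted or proved about them here) the finite-volume inequalities of that
paper — the ones it proves (II.1, III.1, III.2, IV.1, App. A) and the one whose use at weak coupling
K. R. Ito and E. Seiler dispute (*On the recent paper on quark confinement by Tomboulis*,
arXiv:0711.4930 [ItoSeiler2007Tomboulis] §3 eq. (3.4): Tomboulis's (5.15) `A ≥ A⁺`, "as far as we can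
see, not proven"; *Further discussion…*, arXiv:0803.3019 §3.2 Problems 1–3) together with its printed
corollaries (5.22)–(5.23) and the "common interpolation parameter" claim (IS07 Claim 2.1). The barrier
file `Literature/Barriers/QuantumFields/MigdalKadanoffGroupBlindness.lean` records the `U(1)` objection
and states that these objects were not formalised there; this file supplies them so that an exact
small-volume census can refer to kernel-level statements. HONEST FRAMING: finite tori and finite spin
cut-offs only; deciding any instance below says nothing about the thermodynamic limit or confinement.

## Dictionary (Tomboulis §2, eqs. (2.1)–(2.10); IS07 §2 (2.1))

* Gauge group `SU(2) = Matrix.specialUnitaryGroup (Fin 2) ℂ`; spins `j ∈ {0, 1/2, 1, …}` are indexed by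
  `n = 2j ∈ ℕ`, `d_j = n + 1`; the character is `χ_j(U) = sin((2j+1)θ)/sin θ = U_n(cos θ)` with
  `Re tr U = 2 cos θ`, i.e. `su2Char n U = U_n(Re tr U / 2)` (Chebyshev polynomial of the second kind);
  all characters are real and `χ_j(-U) = (-1)^{2j} χ_j(U)`.
* Plaquette function (2.7)/(2.10): `f(U) = 1 + Σ_{j ≠ 0} d_j c_j χ_j(U)` with `0 ≤ c_j ≤ 1` (2.8); here
  `plaqFn J c U = 1 + Σ_{n=1}^{J} (n+1) c(n) χ_n(U)` for a coefficient sequence `c : ℕ → ℝ` and an explicit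
  SPIN CUT-OFF `2j ≤ J` (the printed sums run over all `j`; the Wilson action `(β/2)χ_{1/2}` has
  `c_j(β) = I_{2j+1}(β)/I_1(β)` for all `j` (2.4)–(2.6), so a printed statement is the `J → ∞` case and an
  exact census works at finite `J` with a separately certified tail). Normalised partition function
  (2.7)/(2.10) `Z_Λ({c_j}) = ∫ ∏_p f(U_p) ∏_b dU_b` = `torusZ`.
* Twist (4.1)–(4.5): `Z⁻_Λ` replaces `f(U_p)` by `f(-U_p) = 1 + Σ (-1)^{2j} d_j c_j χ_j(U_p)` on a coclosed
  plaquette set `𝒱` winding around the torus in the `d-2` directions perpendicular to a fixed plane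
  (`plaqFnTwist`, `torusZtw`, `vortexSheet`); `Z⁺ = (Z + Z⁻)/2` (4.7).
* Decimation `Λ^{(n-1)} → Λ^{(n)}` with scale `b`, renormalisation `ζ = b^{d-2}` (MK choice (2.25)) and
  exponent parameter `r` (2.17)–(2.21): `ĉ_j = F̂_j/F̂_0`, `F̂_j = ∫ f^ζ χ_j/d_j dU`, `c_j(n) = ĉ_j^{b² r}`,
  `F_0(n) = F̂_0^{b²}` (`mkFhat`, `mkCoeff`, `mkF0`); upper-bound coefficients `c^U_j` = these at
  `ζ = b^{d-2}` (3.1); lower-bound coefficients `c^L_j = c_j^6` (3.6) or `0` (3.10).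
* Interpolation (3.13) with `c^L = 0`: `c̃_j(α) = w(α) c^U_j`, `w` increasing, `w(0)=0`, `w(1)=1`; IS07 (2.6)
  take `w(α) = α`; since a monotone reparametrisation does not change the sign conditions below, the
  interpolation is rendered by the ray `α ↦ α • c` (`scaleCoeff`).

## What is recorded (all `def … : Prop`, instance by instance in `(d, L, J, c, …)`)

`CoeffMonotone` (II.1(i)), `HypercubeLowerBound` (II.1(ii)), `DecimationUpperBound` (III.1, eq. (3.3)),
`DecimationLowerBound` (III.2, (3.6)–(3.7)), `TwistLe` (IV.1, (4.6)), `Ineq515` (the disputed (5.15) in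
the equivalent form (5.17) `A ≥ A⁻`, i.e. `∂_α log Z ≥ ∂_α log Z⁻` along the interpolation),
`VortexRatioAntitone` ((5.23): `α ↦ Z⁻/Z` non-increasing), `MKTLowerBound` ((5.22), the lower bound of
Prop. V.2: the vortex free-energy ratio is bounded below by its value at the decimated upper-bound
coefficients — "first stated a long time ago in [T]"), `CommonInterpolation` ((5.16)/Prop. V.1 at one
decimation step = IS07 Claim 2.1 (2): a common `α*`).

## Not here

The `t`-parametrised bulk factors `F̃_0(m,h,α,t) = F_0^U(m)^{h(α,t)}` (3.15)–(3.17) and the functions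
`α_{Λ,h}(t)`, `α⁺_{Λ,h}(t)` (3.20), (4.17) (Ito–Seiler's Problems 1–3 are about these; their exact
transcription is pending and will be added append-only); anisotropic tori (the tree's torus is
`(ℤ/Lℤ)^d`); `U(1)` (see the barrier file); the strong-coupling cluster expansion of §6; any claim about
which instances hold.
-/

noncomputable section

open MeasureTheory Finset Real
open scoped BigOperators
open Literature.MathematicalPhysics.QuantumLattice

namespace Literature.MathematicalPhysics.QuantumFieldTheory

namespace Tomboulis2007

/-- The gauge group `SU(2)` as the matrix group `Matrix.specialUnitaryGroup (Fin 2) ℂ`. [folklore] -/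
abbrev SU2 : Type := Matrix.specialUnitaryGroup (Fin 2) ℂ

/-! ### Characters and plaquette functions -/

/-- The character of the spin-`j` representation of `SU(2)`, indexed by `n = 2j ∈ ℕ` (dimension
`d_j = n + 1`), as a function of the group element through `Re tr U = 2 cos θ`:
`χ_j(U) = sin((2j+1)θ)/sin θ = U_n(cos θ)`, `U_n` the Chebyshev polynomial of the second kind
(Weyl character formula for `SU(2)`; Tomboulis 2007 §2 after (2.3): "for SU(2) … all characters are real,
`j = 0, 1/2, 1, …`, and `d_j = 2j+1`"). [folklore] -/
def su2Char (n : ℕ) (U : SU2) : ℝ :=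
  (Polynomial.Chebyshev.U ℝ (n : ℤ)).eval ((U : Matrix (Fin 2) (Fin 2) ℂ).trace.re / 2)

/-- **Tomboulis's normalised plaquette function** `f(U) = 1 + Σ_{j ≠ 0} d_j c_j χ_j(U)` (arXiv:0707.2179
eqs. (2.7), (2.10); IS07 (2.1b)), with coefficients `c(n)` for `n = 2j ≥ 1` and spin cut-off `2j ≤ J`.
[cite: Tomboulis2007Confinement, §2 eqs. (2.7), (2.10)] -/
def plaqFn (J : ℕ) (c : ℕ → ℝ) (U : SU2) : ℝ :=
  1 + ∑ n ∈ Icc 1 J, ((n : ℝ) + 1) * c n * su2Char n U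

/-- **The twisted plaquette function** `f(-U) = 1 + Σ_{j ≠ 0} (-1)^{2j} d_j c_j χ_j(U)`: only half-integer
spins (odd `n`) change sign (arXiv:0707.2179 eqs. (4.3), (4.5)).
[cite: Tomboulis2007Confinement, §4 eqs. (4.3), (4.5)] -/
def plaqFnTwist (J : ℕ) (c : ℕ → ℝ) (U : SU2) : ℝ :=
  1 + ∑ n ∈ Icc 1 J, (-1 : ℝ) ^ n * ((n : ℝ) + 1) * c n * su2Char n U

/-- Tomboulis's standing positivity hypothesis (2.8)/(2.22): `0 ≤ c_j ≤ 1` for all `j ≠ 0` (it gives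
reflection positivity in planes with and without sites). [cite: Tomboulis2007Confinement, §2 eq. (2.8)] -/
def CoeffAdmissible (c : ℕ → ℝ) : Prop :=
  ∀ n, 1 ≤ n → 0 ≤ c n ∧ c n ≤ 1

/-- The interpolation ray `c̃_j(α) = α c_j` (Tomboulis (3.13) with the lower-bound coefficients `c^L_j = 0`
of (3.10) and `w(α) = α`; Ito–Seiler arXiv:0711.4930 (2.6) `c̃_j(α) = α c_j(1)`).
[cite: ItoSeiler2007Tomboulis, §2 eq. (2.6)] -/
def scaleCoeff (α : ℝ) (c : ℕ → ℝ) : ℕ → ℝ := fun n => α * c n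

/-! ### Partition functions on the torus `(ℤ/Lℤ)^d` -/

variable (d L : ℕ) [NeZero L]

/-- **Tomboulis's normalised partition function** `Z_Λ({c_j}) = ∫ ∏_{p ∈ Λ} f_p(U_p) ∏_b dU_b` on the
periodic lattice `Λ = (ℤ/Lℤ)^d` (arXiv:0707.2179 eq. (2.7); (2.10) on the decimated lattices; IS07 (2.4a)).
[cite: Tomboulis2007Confinement, §2 eq. (2.7)] -/
def torusZ (J : ℕ) (c : ℕ → ℝ) : ℝ :=
  ∫ U, ∏ p : Plaquette d L, plaqFn J c (plaquetteHolonomy U p.1 p.2.1.1 p.2.1.2)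
    ∂(Measure.pi fun _ : Edge d L => haarProbability SU2)

/-- **The twisted partition function** `Z⁻_Λ({c_j})` for a twist carried by the plaquette set `V`:
`f(U_p)` is replaced by `f(-U_p)` for `p ∈ V` (arXiv:0707.2179 eqs. (4.1)–(4.5); IS07 (2.7)–(2.9)). For
Tomboulis's `𝒱` take `V = vortexSheet …`; by the change of variables `U_b ↦ -U_b` the value depends only
on the homology class of a coclosed `V` (loc. cit., before (4.3)) — not used in the definition.
[cite: Tomboulis2007Confinement, §4 eqs. (4.4)–(4.5)] -/
def torusZtw (J : ℕ) (c : ℕ → ℝ) (V : Finset (Plaquette d L)) : ℝ :=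
  ∫ U, ∏ p : Plaquette d L,
      (if p ∈ V then plaqFnTwist J c (plaquetteHolonomy U p.1 p.2.1.1 p.2.1.2)
        else plaqFn J c (plaquetteHolonomy U p.1 p.2.1.1 p.2.1.2))
    ∂(Measure.pi fun _ : Edge d L => haarProbability SU2)

/-- `Z⁺ = (Z + Z⁻)/2` (arXiv:0707.2179 eq. (4.7); IS07 before (3.2)). [cite: Tomboulis2007Confinement, §4 eq. (4.7)] -/
def torusZplus (J : ℕ) (c : ℕ → ℝ) (V : Finset (Plaquette d L)) : ℝ :=
  (torusZ d L J c + torusZtw d L J c V) / 2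

variable {d} in
/-- **The vortex sheet** `𝒱_{ij}`: the coclosed set of all plaquettes in the `(i,j)`-plane whose base point
has vanishing `i`- and `j`-coordinates — one plaquette in every `(i,j)`-plane, winding around the torus in
the `d - 2` perpendicular directions (arXiv:0707.2179 §4, first paragraph; IS08 §2: "a plaquette … in an
`x_1–x_2` plane and its translates along the 3rd and 4th axis"). [cite: Tomboulis2007Confinement, §4 (the set 𝒱_{μν})] -/
def vortexSheet (i j : Fin d) (hij : i < j) : Finset (Plaquette d L) :=
  univ.filter fun p => p.2 = ⟨(i, j), hij⟩ ∧ p.1 i = 0 ∧ p.1 j = 0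

/-- The vortex free-energy ratio `Z⁻_Λ/Z_Λ = exp(-F⁻_Λ)` (arXiv:0707.2179 eq. (6.1)).
[cite: Tomboulis2007Confinement, §6 eq. (6.1)] -/
def vortexRatio (J : ℕ) (c : ℕ → ℝ) (V : Finset (Plaquette d L)) : ℝ :=
  torusZtw d L J c V / torusZ d L J c

/-! ### The potential-moving (Migdal–Kadanoff-type) decimation step -/

/-- `F̂_j = ∫ [f(U)]^ζ χ_j(U)/d_j dU` (arXiv:0707.2179 eq. (2.21); IS07 (2.3)): the character coefficients
of the `ζ`-th power of the plaquette function, `ζ ∈ ℕ` the total renormalisation `ζ₀^{d-2}` (2.16) (for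
integer `ζ` positivity of the coefficients is preserved, (2.22)). [cite: Tomboulis2007Confinement, §2 eq. (2.21)] -/
def mkFhat (J : ℕ) (c : ℕ → ℝ) (ζ n : ℕ) : ℝ :=
  ∫ U, plaqFn J c U ^ ζ * (su2Char n U / ((n : ℝ) + 1)) ∂(haarProbability SU2)

/-- **Decimated coefficients** `c_j(n) = ĉ_j^{b² r}`, `ĉ_j = F̂_j/F̂_0` (arXiv:0707.2179 eqs. (2.18),
(2.20); real power `b² r`, `0 < r ≤ 1`, (2.17)/(3.2): `c^U_j(n,r) = c^U_j(n,1)^r`). With `ζ = b^{d-2}`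
these are the UPPER-BOUND coefficients `c^U_j` of (3.1) (the MK recursion at `r = 1`). If `c` is
supported in `2j ≤ J` the result is supported in `2j ≤ ζ J`. For admissible `c` and integer `ζ` all
`F̂_j ≥ 0` (2.22); outside that regime the real power of a negative base is a junk value. [cite: Tomboulis2007Confinement, §2 eqs. (2.18)–(2.21) and §3 eq. (3.1)] -/
def mkCoeff (J : ℕ) (c : ℕ → ℝ) (ζ b : ℕ) (r : ℝ) : ℕ → ℝ :=
  fun n => (mkFhat J c ζ n / mkFhat J c ζ 0) ^ (((b : ℝ) ^ 2) * r)

/-- **The bulk factor** `F_0(n) = F̂_0^{b²}` (arXiv:0707.2179 eq. (2.19)); with `ζ = b^{d-2}` this is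
`F_0^U` of (3.1). [cite: Tomboulis2007Confinement, §2 eq. (2.19)] -/
def mkF0 (J : ℕ) (c : ℕ → ℝ) (ζ b : ℕ) : ℝ :=
  mkFhat J c ζ 0 ^ (b ^ 2)

/-- The lower-bound coefficients `c^L_j(n) = c_j(n-1)^6`, `F^L_0 = 1` (arXiv:0707.2179 eq. (3.6)).
[cite: Tomboulis2007Confinement, §3 eq. (3.6)] -/
def lowerCoeff (c : ℕ → ℝ) : ℕ → ℝ := fun n => c n ^ 6

/-! ### The printed inequalities, as `Prop`s (instance by instance; nothing asserted) -/

/-- **II.1 (i)** (arXiv:0707.2179 eq. (2.13), from reflection positivity in planes without sites):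
`Z_Λ({c_j})` is increasing in each `c_j ≥ 0` — rendered as monotonicity along the coefficient order
between admissible coefficient vectors. [cite: Tomboulis2007Confinement, Prop. II.1 (i), eq. (2.13)] -/
def CoeffMonotone (J : ℕ) : Prop :=
  ∀ c c' : ℕ → ℝ, CoeffAdmissible c → CoeffAdmissible c' → (∀ n, c n ≤ c' n) →
    torusZ d L J c ≤ torusZ d L J c'

/-- **II.1 (ii)** (arXiv:0707.2179 eq. (2.14), App. A eqs. (A.1)–(A.5): chessboard estimate from reflection
positivity, printed for side lengths `2^{m_μ}`): `Z_Λ({c_j}) ≥ [1 + Σ_{j ≠ 0} d_j² c_j^6]^{|Λ|}`, `|Λ|` the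
number of sites (App. A.1), for `c_j ≥ 0`. [cite: Tomboulis2007Confinement, Prop. II.1 (ii), eq. (2.14)] -/
def HypercubeLowerBound (J : ℕ) : Prop :=
  ∀ c : ℕ → ℝ, CoeffAdmissible c →
    (1 + ∑ n ∈ Icc 1 J, ((n : ℝ) + 1) ^ 2 * c n ^ 6) ^ (L ^ d) ≤ torusZ d L J c

/-- **IV.1** (arXiv:0707.2179 eq. (4.6), App. A §5): `Z⁻_Λ({c_j}) ≤ Z_Λ({c_j})` for `c_j ≥ 0`, with the
twist on the vortex sheet. [cite: Tomboulis2007Confinement, Prop. IV.1, eq. (4.6)] -/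
def TwistLe (J : ℕ) (V : Finset (Plaquette d L)) : Prop :=
  ∀ c : ℕ → ℝ, CoeffAdmissible c → torusZtw d L J c V ≤ torusZ d L J c

variable (b : ℕ) [NeZero (b * L)]

/-- **III.1 — the potential-moving UPPER bound** (arXiv:0707.2179 eq. (3.3), App. A §4): one decimation
`Λ^{(n-1)} = (ℤ/bLℤ)^d → Λ^{(n)} = (ℤ/Lℤ)^d` with `ζ = b^{d-2}` and `0 < r ≤ 1` gives
`Z_{Λ^{(n-1)}}({c_j}) ≤ F_0^U(n)^{|Λ^{(n)}|} Z_{Λ^{(n)}}({c^U_j(n,r)})`, `|Λ^{(n)}|` = number of plaquettes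
of `Λ^{(n)}` (App. A §3). Spin cut-offs: `J` before, `b^{d-2} J` after (exact for polynomial plaquette
functions). [cite: Tomboulis2007Confinement, Prop. III.1, eq. (3.3)] -/
def DecimationUpperBound (J : ℕ) (r : ℝ) : Prop :=
  ∀ c : ℕ → ℝ, CoeffAdmissible c →
    torusZ d (b * L) J c ≤
      mkF0 J c (b ^ (d - 2)) b ^ Fintype.card (Plaquette d L) *
        torusZ d L (b ^ (d - 2) * J) (mkCoeff J c (b ^ (d - 2)) b r)

/-- **III.2 — the LOWER bound** (arXiv:0707.2179 eqs. (3.6)–(3.7), App. A §3):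
`Z_{Λ^{(n)}}({c_j(n-1)^6}) ≤ Z_{Λ^{(n-1)}}({c_j(n-1)})`. [cite: Tomboulis2007Confinement, Prop. III.2, eq. (3.7)] -/
def DecimationLowerBound (J : ℕ) : Prop :=
  ∀ c : ℕ → ℝ, CoeffAdmissible c → torusZ d L J (lowerCoeff c) ≤ torusZ d (b * L) J c

variable {d} in
/-- **(5.22), lower half — the MK–Tomboulis vortex inequality** (arXiv:0707.2179 Prop. V.2, eq. (5.22):
`Z⁻_Λ/Z_Λ ≥ Z⁻_{Λ^{(n)}}({c^U_j(n)})/Z_{Λ^{(n)}}({c^U_j(n)})`, "first stated a long time ago in [T]";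
derived there from V.1, hence from the disputed (5.15)): after one decimation `(ℤ/bLℤ)^d → (ℤ/Lℤ)^d`
the vortex free-energy ratio at the upper-bound coefficients bounds the original ratio from below; vortex
sheets in the same plane `(i,j)` on both tori. [cite: Tomboulis2007Confinement, Prop. V.2, eq. (5.22)] -/
def MKTLowerBound (J : ℕ) (r : ℝ) (i j : Fin d) (hij : i < j) : Prop :=
  ∀ c : ℕ → ℝ, CoeffAdmissible c →
    vortexRatio d L (b ^ (d - 2) * J) (mkCoeff J c (b ^ (d - 2)) b r) (vortexSheet L i j hij) ≤
      vortexRatio d (b * L) J c (vortexSheet (b * L) i j hij)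

variable {d} in
/-- **(5.16) / Prop. V.1 at one decimation step — the common interpolation parameter** (arXiv:0707.2179
eq. (5.16) with `n = 1`; Ito–Seiler arXiv:0711.4930 Claim 2.1 and arXiv:0803.3019 Claim 2.1 (2),
§3.2 Problem 2): there is `α* ∈ (0,1)` with
`Z⁻_Λ({c_j})/Z_Λ({c_j}) = Z⁻_{Λ^{(1)}}({α* c^U_j})/Z_{Λ^{(1)}}({α* c^U_j})`. (Given IV.1 and continuity
this follows from `MKTLowerBound` by the intermediate value theorem; Tomboulis obtains it from (5.15).)
[cite: ItoSeiler2007Tomboulis, §2 Claim 2.1] -/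
def CommonInterpolation (J : ℕ) (r : ℝ) (i j : Fin d) (hij : i < j) (c : ℕ → ℝ) : Prop :=
  ∃ α ∈ Set.Ioo (0 : ℝ) 1,
    vortexRatio d (b * L) J c (vortexSheet (b * L) i j hij) =
      vortexRatio d L (b ^ (d - 2) * J) (scaleCoeff α (mkCoeff J c (b ^ (d - 2)) b r))
        (vortexSheet L i j hij)

omit [NeZero (b * L)] in
/-- **THE DISPUTED INEQUALITY (5.15), in the equivalent form (5.17) `A ≥ A⁻`** (arXiv:0707.2179
eqs. (5.15), (5.17) with (3.27): `A_{Λ}(α) = (ln F_0^U)^{-1}|Λ|^{-1} ∂_α ln Z_Λ({c̃_j(α)})`, `A⁻` the same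
with `Z⁻`; the positive prefactor cancels): along the interpolation ray `c̃(α) = α c`,
`∂_α log Z⁻_Λ(c̃(α)) ≤ ∂_α log Z_Λ(c̃(α))` for all `α ∈ (0,1)`. Tomboulis (§5 before V.1; reply
arXiv:0712.2620): "we need establish inequality (5.15) only at strong coupling … Within this expansion it is
a straightforward exercise"; Ito–Seiler arXiv:0711.4930 §3 (3.4): "as far as we can see, not proven … This
inequality is obvious when {c_j ≥ 0} are small and the formal expansion converges". Instance by instance in
the torus, the cut-off, the coefficient vector `c` (bare Wilson or decimated) and the twist set.
[cite: Tomboulis2007Confinement, §5 eqs. (5.15), (5.17)] [cite: ItoSeiler2007Tomboulis, §3 eq. (3.4)] -/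
def Ineq515 (J : ℕ) (c : ℕ → ℝ) (V : Finset (Plaquette d L)) : Prop :=
  ∀ α ∈ Set.Ioo (0 : ℝ) 1,
    deriv (fun a => Real.log (torusZtw d L J (scaleCoeff a c) V)) α ≤
      deriv (fun a => Real.log (torusZ d L J (scaleCoeff a c))) α

omit [NeZero (b * L)] in
/-- **(5.23)** (arXiv:0707.2179 eq. (5.23): `d/dα [Z⁻_{Λ}({c̃_j(α)})/Z_{Λ}({c̃_j(α)})] < 0`, "by (5.17)"):
the vortex free-energy ratio is non-increasing along the interpolation ray — the integrated,
derivative-free form of `Ineq515`. [cite: Tomboulis2007Confinement, §5 eq. (5.23)] -/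
def VortexRatioAntitone (J : ℕ) (c : ℕ → ℝ) (V : Finset (Plaquette d L)) : Prop :=
  AntitoneOn (fun α => vortexRatio d L J (scaleCoeff α c) V) (Set.Icc (0 : ℝ) 1)

end Tomboulis2007

end Literature.MathematicalPhysics.QuantumFieldTheory

/-! ## Revision 2 (append-only): the `t`-parametrised interpolation and Ito–Seiler's Problem 2;
the printed exponent of II.1 (ii); errata to the equation numbers quoted above

### Errata (equation numbers of arXiv:0707.2179v1, aligned with the cell's as-printed transcription
`lit/TRACK-B-AS-PRINTED.md`; statements above are unaffected)
`plaqFn`: the plaquette function is (2.5)–(2.6) (and (2.9) on decimated lattices), not "(2.7), (2.10)";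
`mkFhat` = (2.22), `ĉ_j` = (2.21), `c_j(n) = ĉ_j^{b²r}` = (2.19), `mkF0` = (2.20), `ζ = ζ₀^{d-2}` = (2.17),
MK choice = (2.30); upper-bound coefficients (3.1)–(3.3); `lowerCoeff` `c^L = c^6` = (3.5), the choice
`c^L = 0` is (3.9) (not (3.10), which is `c^{b²}`); the interpolation `c̃` is (3.12); `plaqFnTwist` =
(4.4), `Z⁻` = (4.2)–(4.4), Prop. IV.1 = (4.5), `Z⁺` = (4.8); II.1 (i) = (2.12), II.1 (ii) = (2.13) — and
there `|Λ^{(n)}|` is, in the paper's own convention, the number of PLAQUETTES, while the proof App. A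
(A.4)–(A.5) delivers the exponent "number of unit hypercubes" (see `HypercubeLowerBoundExp` below);
III.1 = (3.4); (5.15) ⇔ (5.16) (`A ≥ A⁻`); Prop. V.1 = (5.17)–(5.18); V.2 (two-sided) = (5.23), its lower
half (5.22); `d/dα (Z⁻/Z) < 0` = (5.24).
-/

namespace Literature.MathematicalPhysics.QuantumFieldTheory

namespace Tomboulis2007

open MeasureTheory Finset Real

variable (d L : ℕ) [NeZero L]

/-- **II.1 (ii) with the exponent as a parameter** (arXiv:0707.2179 eq. (2.13):
`Z_{Λ^{(n)}}({c_j}) ≥ [1 + Σ_{j≠0} d_j² c_j^6]^{|Λ^{(n)}|}`): `HypercubeLowerBoundExp d L J m` is the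
inequality with exponent `m`. As printed `m = |Λ^{(n)}|` = number of plaquettes
(`Fintype.card (Plaquette d L)`); App. A (A.4)–(A.5) proves it with `m` = number of unit hypercubes of a
torus of side lengths `2^{m_μ}`; `HypercubeLowerBound` above is the instance `m = L^d` (sites). Which
exponents hold on which tori is a census question (cell item C2). [cite: Tomboulis2007Confinement, Prop. II.1 (ii), eq. (2.13)] -/
def HypercubeLowerBoundExp (J m : ℕ) : Prop :=
  ∀ c : ℕ → ℝ, CoeffAdmissible c →
    (1 + ∑ n ∈ Icc 1 J, ((n : ℝ) + 1) ^ 2 * c n ^ 6) ^ m ≤ torusZ d L J c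

/-- **The bulk-factor interpolation function** `h(α, t) = exp(-t(1-α)/α)` (arXiv:0707.2179 eq. (3.18),
first example, with `σ(t) = t`; Ito–Seiler arXiv:0711.4930 eq. (2.5)): increasing in `α` on `(0,1]`,
`h → 0` as `α ↓ 0`, `h(1,t) = 1`, decreasing in `t`. (Junk value `exp 0 = 1` at `α = 0`.)
[cite: ItoSeiler2007Tomboulis, §2 eq. (2.5)] -/
def interpH (α t : ℝ) : ℝ :=
  Real.exp (-(t * (1 - α) / α))

variable (b : ℕ) [NeZero (b * L)]

/-- **The interpolated partition function after one decimation**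
`Z̃_{Λ^{(1)}}(α, t) = F_0^U(1)^{h(α,t)|Λ^{(1)}|} · Z_{Λ^{(1)}}({α c^U_j(1, r)})` (arXiv:0707.2179 eqs.
(3.16), (3.19) with `c^L = 0` (3.9), `w(α) = α`; Ito–Seiler arXiv:0711.4930 eqs. (2.4)–(2.6)): coarse
torus `(ℤ/Lℤ)^d`, `|Λ^{(1)}|` = its number of plaquettes, `c^U` = `mkCoeff` with `ζ = b^{d-2}`, real
power of the bulk factor. [cite: Tomboulis2007Confinement, §3 eqs. (3.16), (3.19)] -/
def tildeZ (J : ℕ) (r : ℝ) (c : ℕ → ℝ) (α t : ℝ) : ℝ :=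
  mkF0 J c (b ^ (d - 2)) b ^ (interpH α t * (Fintype.card (Plaquette d L) : ℝ)) *
    torusZ d L (b ^ (d - 2) * J) (scaleCoeff α (mkCoeff J c (b ^ (d - 2)) b r))

variable {d} in
/-- **The interpolated `Z⁺` after one decimation**, `F_0^U^{h(α,t)|Λ^{(1)}|} · Z⁺_{Λ^{(1)}}({α c^U_j})`
(arXiv:0707.2179 eqs. (4.14)–(4.15)), vortex sheet in the plane `(i, j)` of the coarse torus.
[cite: Tomboulis2007Confinement, §4 eqs. (4.14)–(4.15)] -/
def tildeZplus (J : ℕ) (r : ℝ) (i j : Fin d) (hij : i < j) (c : ℕ → ℝ) (α t : ℝ) : ℝ :=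
  mkF0 J c (b ^ (d - 2)) b ^ (interpH α t * (Fintype.card (Plaquette d L) : ℝ)) *
    torusZplus d L (b ^ (d - 2) * J) (scaleCoeff α (mkCoeff J c (b ^ (d - 2)) b r))
      (vortexSheet L i j hij)

/-- **The defining equation of `α_Λ(t)`** (arXiv:0707.2179 eqs. (3.23)–(3.24) at the first step;
Ito–Seiler arXiv:0711.4930 (2.4): "α = α(t) ∈ [0,1] is chosen so that the above relation becomes
exact"): `Z̃_{Λ^{(1)}}(α, t) = Z_Λ({c_j})`, the right side the ORIGINAL normalised partition function on
the fine torus `(ℤ/bLℤ)^d`. [cite: Tomboulis2007Confinement, §3 eqs. (3.23)–(3.24)] -/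
def IsAlpha (J : ℕ) (r : ℝ) (c : ℕ → ℝ) (t α : ℝ) : Prop :=
  α ∈ Set.Ioo (0 : ℝ) 1 ∧ tildeZ d L b J r c α t = torusZ d (b * L) J c

variable {d} in
/-- **The defining equation of `α⁺_Λ(t)`** (arXiv:0707.2179 eqs. (4.18)–(4.19) at the first step;
Ito–Seiler arXiv:0711.4930 (3.1b)): `F_0^U^{h(α,t)|Λ^{(1)}|} Z⁺_{Λ^{(1)}}({α c^U_j}) = Z⁺_Λ({c_j})`, vortex
sheets in the same plane on both tori. [cite: Tomboulis2007Confinement, §4 eqs. (4.18)–(4.19)] -/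
def IsAlphaPlus (J : ℕ) (r : ℝ) (i j : Fin d) (hij : i < j) (c : ℕ → ℝ) (t α : ℝ) : Prop :=
  α ∈ Set.Ioo (0 : ℝ) 1 ∧
    tildeZplus L b J r i j hij c α t = torusZplus d (b * L) J c (vortexSheet (b * L) i j hij)

variable {d} in
/-- **Ito–Seiler's PROBLEM 2 / Tomboulis's (5.14) at the first decimation step** (arXiv:0803.3019
§3.2 Problem 2: "The existence of `t*` satisfying `α⁺(t*) = α(t*)` is not established"; arXiv:0711.4930
eq. (3.2); arXiv:0707.2179 eq. (5.14)): there is `t* > 0` and a COMMON `α* ∈ (0,1)` solving both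
defining equations, `Z̃(α*, t*) = Z_Λ` and `Z̃⁺(α*, t*) = Z⁺_Λ` (by III.3 / IV.5 the solution `α` of each
equation at fixed `t` is unique when it exists, so this is exactly `α_Λ(t*) = α⁺_Λ(t*)`). Dividing the
two equations gives `CommonInterpolation`. Instance by instance in `(d, L, b, J, r, plane, c)`; a census
row decides it on one finite torus pair and says nothing about the thermodynamic limit.
[cite: ItoSeiler2007Tomboulis, §3 eq. (3.2)] [cite: Tomboulis2007Confinement, §5 eq. (5.14)] -/
def ISProblem2 (J : ℕ) (r : ℝ) (i j : Fin d) (hij : i < j) (c : ℕ → ℝ) : Prop :=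
  ∃ t : ℝ, 0 < t ∧ ∃ α : ℝ, IsAlpha d L b J r c t α ∧ IsAlphaPlus L b J r i j hij c t α

end Tomboulis2007

end Literature.MathematicalPhysics.QuantumFieldTheory
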